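import Summits.QuantumFields.YangMills.Theorems.UnitScaleTiltFluctuationComparisonRegPrDualWhitney1D

/-!
# Route `UnitScaleTilt` — crux K1bR-pr `FluctuationComparisonRegPr` (stmt-QuantumFields-19201), stub `stub_oneStepSmallLift`
# (W7 line), piece (L1) FOR EVERY ODD BLOCK SIZE: DUALITY, PARTITION OF UNITY, POLYPHASE BOUNDS AND GAIN of the
# one-dimensional «dual Whitney» profiles (sequel of `…DualWhitney1D`; `--supports stmt-QuantumFields-19201`; seat `ym3-torus-p1` gen 10)

For the profiles `phi1`, `phi0` of `…DualWhitney1D` (block size `L = 2h+1`):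
* `sum_phi0_eq`: TRANSVERSE DUALITY `Σ_{i<L} Φ₀(Ln − h + i) = L·[n = 0]` (box average of the translates = Kronecker delta);
* `sum_sum_phi1_eq`: LONGITUDINAL DUALITY `Σ_{i<L} Σ_{t<L} Φ₁(Ln − h + i + t) = L²·[n = 0]` («box × line» average), `h ≥ 1`;
* `phi0_pu`: PARTITION OF UNITY `Φ₀(s−L) + Φ₀(s) + Φ₀(s+L) = 1`, `|s| ≤ h`;
* `polyphase_phi1` / `polyphase_phi0`: `|Φ(s−L)| + |Φ(s)| + |Φ(s+L)| = C` resp. `≤ C`, `|s| ≤ h`, `C = 2L²/(L²+1)`;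
* `gain_eq`, `gain_mul_sqrt_lt_one`: `C³/L² = 8L⁴/(L²+1)³` and `8L⁴/(L²+1)³·√L < 1` for `h ≥ 2` (`L ≥ 5`).
These are exactly the one-dimensional inputs of `S∘R₁ = 1` (duality), `d₀R₀ = R₁d₀`/gauge-blindness (partition of unity) and of the
sup-norm bound `‖R₂‖_{∞→∞} ≤ C³/L²` (polyphase) for the tensor interpolants of `…DualWhitney3D`.  Elementary; nothing printed is asserted.
-/

noncomputable section

namespace Summit.QuantumFields.YangMills.Theorems.DualWhitney

open Finset

variable (h : ℕ)

/-! ## §4 Transverse and longitudinal duality -/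

/-- `range L = range (h + (h+1))`. -/
theorem range_bL : range (bL h) = range (h + (h + 1)) := by unfold bL; congr 1; ring

/-- Central window: `Σ_{i<L} Φ₀(−h + i) = L`. -/
theorem sum_phi0_center : ∑ i ∈ range (bL h), phi0 h (-(h : ℤ) + i) = bL h := by
  rw [range_bL, sum_range_add]
  have e1 : ∑ i ∈ range h, phi0 h (-(h : ℤ) + (i : ℕ))
      = ∑ i ∈ range h, ((2 * h * cu h + cC h - cC h * h) / bL h + (cC h / bL h) * (i : ℝ)) :=
    sum_congr rfl fun i hi => by
      have hi' := mem_range.mp hi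
      rw [phi0_A (by omega) (by omega)]; push_cast; ring
  have e2 : ∑ i ∈ range (h + 1), phi0 h (-(h : ℤ) + ((h + i : ℕ) : ℤ))
      = ∑ i ∈ range (h + 1), ((2 * h * cu h + cC h) / bL h + (-(cC h) / bL h) * (i : ℝ)) :=
    sum_congr rfl fun i hi => by
      have hi' := mem_range.mp hi
      rw [show -(h : ℤ) + ((h + i : ℕ) : ℤ) = i by push_cast; ring, phi0_B0 (by omega) (by omega)]; push_cast; ring
  rw [e1, e2, sum_range_affine, sum_range_affine]
  have hL := bL_pos h
  unfold cu cC; rw [bL_cast]; push_cast; field_simp; ring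

/-- Right window: `Σ_{i<L} Φ₀(L − h + i) = 0` (the balance `u(h+1) = w(3h+1)`). -/
theorem sum_phi0_right : ∑ i ∈ range (bL h), phi0 h ((bL h : ℤ) - h + i) = 0 := by
  rw [range_bL, sum_range_add, sum_range_succ, bL_int]
  have e1 : ∑ i ∈ range h, phi0 h (2 * (h : ℤ) + 1 - h + (i : ℕ))
      = ∑ i ∈ range h, ((cu h * h - cw h * h) / bL h + (-(cu h) / bL h) * (i : ℝ)) :=
    sum_congr rfl fun i hi => by
      have hi' := mem_range.mp hi
      rw [phi0_Cp (by omega) (by omega)]; push_cast; ring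
  have e2 : ∑ i ∈ range h, phi0 h (2 * (h : ℤ) + 1 - h + ((h + i : ℕ) : ℤ))
      = ∑ i ∈ range h, ((-(cw h * h)) / bL h + (cw h / bL h) * (i : ℝ)) :=
    sum_congr rfl fun i hi => by
      have hi' := mem_range.mp hi
      rw [phi0_Dp (by omega) (by omega)]; push_cast; ring
  have e3 : phi0 h (2 * (h : ℤ) + 1 - h + ((h + h : ℕ) : ℤ)) = 0 := phi0_zeroR (by omega)
  rw [e1, e2, e3, sum_range_affine, sum_range_affine]
  have hL := bL_pos h
  unfold cu cw; rw [bL_cast]; field_simp; ring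

/-- Left window: `Σ_{i<L} Φ₀(−L − h + i) = 0`. -/
theorem sum_phi0_left : ∑ i ∈ range (bL h), phi0 h (-(bL h : ℤ) - h + i) = 0 := by
  rw [range_bL, show h + (h + 1) = (h + h) + 1 by ring, sum_range_succ', sum_range_add, bL_int]
  have e1 : ∑ i ∈ range h, phi0 h (-(2 * (h : ℤ) + 1) - h + ((i + 1 : ℕ) : ℤ))
      = ∑ i ∈ range h, ((-(cw h)) / bL h + (-(cw h) / bL h) * (i : ℝ)) :=
    sum_congr rfl fun i hi => by
      have hi' := mem_range.mp hi
      rw [phi0_Dm (by omega) (by omega)]; push_cast; ring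
  have e2 : ∑ i ∈ range h, phi0 h (-(2 * (h : ℤ) + 1) - h + ((h + i + 1 : ℕ) : ℤ))
      = ∑ i ∈ range h, ((cu h - cw h * h) / bL h + (cu h / bL h) * (i : ℝ)) :=
    sum_congr rfl fun i hi => by
      have hi' := mem_range.mp hi
      rw [phi0_Cm (by omega) (by omega)]; push_cast; ring
  have e3 : phi0 h (-(2 * (h : ℤ) + 1) - h + ((0 : ℕ) : ℤ)) = 0 := phi0_zeroL (by omega)
  rw [e1, e2, e3, sum_range_affine, sum_range_affine]
  have hL := bL_pos h
  unfold cu cw; rw [bL_cast]; field_simp; ring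

/-- Far windows: `Σ_{i<L} Φ₀(a − h + i) = 0` when `|a| ≥ 4h + 1`. -/
theorem sum_phi0_far {a : ℤ} (ha : a ≤ -(4 * (h : ℤ)) - 1 ∨ 4 * (h : ℤ) + 1 ≤ a) :
    ∑ i ∈ range (bL h), phi0 h (a - h + i) = 0 := by
  refine sum_eq_zero fun i hi => ?_
  have hi' : (i : ℤ) < bL h := by exact_mod_cast mem_range.mp hi
  rw [bL_int] at hi'
  rcases ha with ha | ha
  · exact phi0_zeroL (by omega)
  · exact phi0_zeroR (by omega)

/-- **TRANSVERSE DUALITY**: `Σ_{i<L} Φ₀(Ln − h + i) = L·[n = 0]` — the box average over the block centred at `Ln` of the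
transverse profile is the Kronecker delta. -/
theorem sum_phi0_eq (n : ℤ) :
    ∑ i ∈ range (bL h), phi0 h ((bL h : ℤ) * n - h + i) = if n = 0 then (bL h : ℝ) else 0 := by
  rcases lt_trichotomy n 0 with hn | rfl | hn
  · rw [if_neg hn.ne]
    rcases (show n = -1 ∨ n ≤ -2 by omega) with rfl | hn2
    · simpa using sum_phi0_left h
    · refine sum_phi0_far h (Or.inl ?_)
      have : (bL h : ℤ) * n ≤ (bL h : ℤ) * (-2) := mul_le_mul_of_nonneg_left hn2 (by positivity)
      rw [bL_int] at this ⊢; omega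
  · simpa using sum_phi0_center h
  · rw [if_neg hn.ne']
    rcases (show n = 1 ∨ 2 ≤ n by omega) with rfl | hn2
    · simpa using sum_phi0_right h
    · refine sum_phi0_far h (Or.inr ?_)
      have : (bL h : ℤ) * 2 ≤ (bL h : ℤ) * n := mul_le_mul_of_nonneg_left hn2 (by positivity)
      rw [bL_int] at this ⊢; omega

/-- **LONGITUDINAL DUALITY**: `Σ_{i<L} Σ_{t<L} Φ₁(Ln − h + i + t) = L²·[n = 0]` — the «box × line» average of the longitudinal
profile is the Kronecker delta (`h ≥ 1`). -/
theorem sum_sum_phi1_eq (hh : 1 ≤ h) (n : ℤ) :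
    ∑ i ∈ range (bL h), ∑ t ∈ range (bL h), phi1 h ((bL h : ℤ) * n - h + i + t)
      = if n = 0 then (bL h : ℝ) ^ 2 else 0 := by
  have : ∑ i ∈ range (bL h), ∑ t ∈ range (bL h), phi1 h ((bL h : ℤ) * n - h + i + t)
      = (bL h : ℝ) * ∑ i ∈ range (bL h), phi0 h ((bL h : ℤ) * n - h + i) := by
    rw [mul_sum]
    exact sum_congr rfl fun i _ => (phi0_window h hh _).symm
  rw [this, sum_phi0_eq]
  split_ifs <;> ring

/-! ## §5 Partition of unity and polyphase bounds (per residue `s ∈ [−h, h]`) -/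

/-- **PARTITION OF UNITY**: `Φ₀(s − L) + Φ₀(s) + Φ₀(s + L) = 1` for `|s| ≤ h` (all other translates vanish). -/
theorem phi0_pu {s : ℤ} (h1 : -(h : ℤ) ≤ s) (h2 : s ≤ h) :
    phi0 h (s - bL h) + phi0 h s + phi0 h (s + bL h) = 1 := by
  have hL := bL_pos h
  rw [bL_int]
  rcases lt_trichotomy s 0 with hs | rfl | hs
  · rw [phi0_Dm1 (by omega) (by omega), phi0_A h1 hs.le, phi0_Cp (by omega) (by omega)]
    unfold cu cw cC; rw [bL_cast]; push_cast; field_simp; ring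
  · rw [phi0_Dm1 (by omega) (by omega), phi0_A h1 le_rfl, phi0_Dp1 (by omega) (by omega)]
    unfold cu cw cC; rw [bL_cast]; push_cast; field_simp; ring
  · rw [phi0_Cm (by omega) (by omega), phi0_B hs h2, phi0_Dp1 (by omega) (by omega)]
    unfold cu cw cC; rw [bL_cast]; push_cast; field_simp; ring

/-- **POLYPHASE IDENTITY FOR `Φ₁`**: `|Φ₁(s − L)| + |Φ₁(s)| + |Φ₁(s + L)| = C` for every residue `|s| ≤ h`. -/
theorem polyphase_phi1 {s : ℤ} (h1 : -(h : ℤ) ≤ s) (h2 : s ≤ h) :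
    |phi1 h (s - bL h)| + |phi1 h s| + |phi1 h (s + bL h)| = cC h := by
  have hu := cu_pos h; have hw := cw_pos h; have hC := cC_pos h
  rw [bL_int, phi1_zeroL (by omega), abs_zero, zero_add]
  rcases lt_trichotomy s h with hs | hs | hs
  · rcases lt_or_ge s 0 with hs' | hs'
    · rw [phi1_wingL h1 (by omega), phi1_plat (by omega) (by omega) (by omega), abs_neg, abs_of_pos hw, abs_of_pos hu,
        ← cu_add_cw]; ring
    · rw [phi1_plat hs' (by omega) hs.ne, phi1_wingR (by omega) (by omega), abs_neg, abs_of_pos hw, abs_of_pos hu,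
        ← cu_add_cw]
  · rw [phi1_ctr hs, phi1_zeroR (by omega), abs_zero, add_zero, abs_of_pos hC]
  · exfalso; omega

section Eval3
variable {h}

/-- `Φ₀` on `[−2h−1, −h)` (the formulas `Cm` and `Dm` agree at `−2h−1`). -/
theorem phi0_Cm1 {s : ℤ} (h1 : -(2 * (h : ℤ)) - 1 ≤ s) (h2 : s < -h) :
    phi0 h s = (cu h * (2 * h + 1 + s) - cw h * h) / bL h := by
  rcases (show -(2 * (h:ℤ)) ≤ s ∨ s = -(2 * h) - 1 by omega) with h3 | h3
  · exact phi0_Cm h3 h2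
  · rw [phi0_Dm1 (by omega) (by omega), h3]; push_cast; ring

end Eval3

/-- **POLYPHASE BOUND FOR `Φ₀`**: `|Φ₀(s − L)| + |Φ₀(s)| + |Φ₀(s + L)| ≤ C` for every residue `|s| ≤ h` (equality at `s = 0`). -/
theorem polyphase_phi0 {s : ℤ} (h1 : -(h : ℤ) ≤ s) (h2 : s ≤ h) :
    |phi0 h (s - bL h)| + |phi0 h s| + |phi0 h (s + bL h)| ≤ cC h := by
  have hL := bL_pos h; have hu := cu_pos h; have hw := cw_pos h; have hC := cC_pos h
  have huw := cw_le_cu h; have hCuw := cu_add_cw h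
  have h0 : (0 : ℝ) ≤ h := Nat.cast_nonneg h
  have hLc := bL_cast h
  set S : ℝ := ((s : ℤ) : ℝ) with hS
  have hS1 : -(h : ℝ) ≤ S := by rw [hS]; exact_mod_cast h1
  have hS2 : S ≤ h := by rw [hS]; exact_mod_cast h2
  have F1 : (h : ℝ) * cC h = h * cu h + h * cw h := by rw [← hCuw]; ring
  have F2 : cC h * S = cu h * S + cw h * S := by rw [← hCuw]; ring
  have F5 : 0 ≤ (h : ℝ) * cw h := mul_nonneg h0 hw.le
  have F6 : cu h * (-(h : ℝ)) ≤ cu h * S := mul_le_mul_of_nonneg_left hS1 hu.le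
  have F7 : cw h * (-(h : ℝ)) ≤ cw h * S := mul_le_mul_of_nonneg_left hS1 hw.le
  have F8 : (h : ℝ) * cw h ≤ h * cu h := mul_le_mul_of_nonneg_left huw h0
  have F9 : cw h * S ≤ cw h * h := mul_le_mul_of_nonneg_left hS2 hw.le
  have F10 : cC h * S ≤ cC h * h := mul_le_mul_of_nonneg_left hS2 hC.le
  rw [bL_int]
  rcases lt_or_ge s 0 with hs | hs
  · have hs' : S < 0 := by rw [hS]; exact_mod_cast hs
    have F3 : cu h * S ≤ 0 := mul_nonpos_of_nonneg_of_nonpos hu.le hs'.le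
    have F4 : cw h * S ≤ 0 := mul_nonpos_of_nonneg_of_nonpos hw.le hs'.le
    have hT1 : phi0 h (s - (2 * h + 1)) = -(cw h * (h + S)) / bL h := by
      rw [phi0_Dm1 (by omega) (by omega)]; push_cast; ring
    have hT2 : phi0 h s = (2 * h * cu h + cC h + cC h * S) / bL h := phi0_A h1 hs.le
    have hT3 : phi0 h (s + (2 * h + 1)) = -(cu h * S + cw h * h) / bL h := by
      rw [phi0_Cp (by omega) (by omega)]; push_cast; ring
    rw [hT1, hT2, hT3, abs_div, abs_div, abs_div, abs_of_pos hL, abs_neg, abs_neg,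
      abs_of_nonneg (show 0 ≤ cw h * (h + S) from mul_nonneg hw.le (by linarith)),
      abs_of_nonneg (show 0 ≤ 2 * h * cu h + cC h + cC h * S by nlinarith), ← add_div, ← add_div,
      div_le_iff₀ hL, hLc]
    have key : |cu h * S + cw h * h| ≤ cC h * (2 * h + 1) - cw h * (h + S) - (2 * h * cu h + cC h + cC h * S) :=
      abs_le.mpr ⟨by nlinarith, by nlinarith⟩
    linarith
  · have hs' : 0 ≤ S := by rw [hS]; exact_mod_cast hs
    have F3 : 0 ≤ cu h * S := mul_nonneg hu.le hs'
    have F4 : 0 ≤ cw h * S := mul_nonneg hw.le hs'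
    have hT1 : phi0 h (s - (2 * h + 1)) = (cu h * S - cw h * h) / bL h := by
      rw [phi0_Cm1 (by omega) (by omega)]; push_cast; ring
    have hT2 : phi0 h s = (2 * h * cu h + cC h - cC h * S) / bL h := phi0_B0 hs h2
    have hT3 : phi0 h (s + (2 * h + 1)) = -(cw h * (h - S)) / bL h := by
      rw [phi0_Dp1 (by omega) (by omega)]; push_cast; ring
    rw [hT1, hT2, hT3, abs_div, abs_div, abs_div, abs_of_pos hL, abs_neg,
      abs_of_nonneg (show 0 ≤ cw h * (h - S) from mul_nonneg hw.le (by linarith)),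
      abs_of_nonneg (show 0 ≤ 2 * h * cu h + cC h - cC h * S by nlinarith), ← add_div, ← add_div,
      div_le_iff₀ hL, hLc]
    have key : |cu h * S - cw h * h| ≤ cC h * (2 * h + 1) - (2 * h * cu h + cC h - cC h * S) - cw h * (h - S) :=
      abs_le.mpr ⟨by nlinarith, by nlinarith⟩
    linarith

/-! ## §6 The gain `C³/L² = 8L⁴/(L²+1)³` and `8L⁴/(L²+1)³ · √L < 1` for `L ≥ 5` -/

/-- `C³/L² = 8L⁴/(L²+1)³` — the sup-norm gain of the tensor interpolant `R₂ = L⁻²·Φ₁⊗Φ₁⊗Φ₀` (companion file) equals the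
norm of the non-local «Whitney ⊗ B⁻¹» lift of IR-NODE §13.2. -/
theorem gain_eq : cC h ^ 3 / (bL h : ℝ) ^ 2 = 8 * (bL h : ℝ) ^ 4 / ((bL h : ℝ) ^ 2 + 1) ^ 3 := by
  have hL := bL_pos h
  unfold cC; field_simp; ring

/-- **THE GAIN BEATS `L^{-1/2}` FOR EVERY `L ≥ 5`** (`h ≥ 2`): `8L⁴/(L²+1)³ · √L < 1`.  (At `L = 3` the left side is
`0.648·√3 > 1`: the construction does not serve `L = 3`, where the certificates CertL3/CertL3Face of seat p2 apply.) -/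
theorem gain_mul_sqrt_lt_one (hh : 2 ≤ h) :
    8 * (bL h : ℝ) ^ 4 / ((bL h : ℝ) ^ 2 + 1) ^ 3 * Real.sqrt (bL h) < 1 := by
  have hL := bL_pos h
  have hh' : (2 : ℝ) ≤ h := by exact_mod_cast hh
  have hL5 : (5 : ℝ) ≤ bL h := by rw [bL_cast]; linarith
  set L : ℝ := (bL h : ℝ) with hLdef
  have hsqrt : Real.sqrt L ≤ L / 2 := by
    rw [Real.sqrt_le_iff]; constructor
    · positivity
    · nlinarith
  have hD : (0 : ℝ) < (L ^ 2 + 1) ^ 3 := by positivity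
  rw [div_mul_eq_mul_div, div_lt_one hD]
  have h1 : 8 * L ^ 4 * Real.sqrt L ≤ 8 * L ^ 4 * (L / 2) := mul_le_mul_of_nonneg_left hsqrt (by positivity)
  have h5 : 5 * L ^ 5 ≤ L ^ 6 := by
    have : 5 * L ^ 5 ≤ L * L ^ 5 := mul_le_mul_of_nonneg_right hL5 (by positivity)
    nlinarith
  nlinarith [pow_pos hL 2, pow_pos hL 4]

/-- Packaged form used by the stub's `κ·√L ≤ 1` clause: with `κ := C³/L²`, `κ·√L < 1` for `h ≥ 2`. -/
theorem gain_mul_sqrt_lt_one' (hh : 2 ≤ h) : cC h ^ 3 / (bL h : ℝ) ^ 2 * Real.sqrt (bL h) < 1 := by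
  rw [gain_eq]; exact gain_mul_sqrt_lt_one h hh

end Summit.QuantumFields.YangMills.Theorems.DualWhitney
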